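import Summits.QuantumFields.YangMills.Theorems.UnitScaleTiltProp7CovWeightedRowBricks
import Summits.QuantumFields.YangMills.Theorems.UnitScaleTiltProp7CovInterpErrorPinRows
import HarnessLib

/-!
# Route `UnitScaleTilt`, crux K1 «MinimiserStabilityRegPr» (stmt-QuantumFields-19200), route-R E′ path (α′), (E1-b) covariant, row (hK₂-cov) — FILE F4b-cov (iii) «THE WEIGHTED ROW»:
# `w(x)·‖Δ_U(φ − φ_H)(x)‖ ≤ ℓ·M + A·(1+2N²)²·(1+t)²·√𝓜∕√ℓ` ON A GENERIC TORUS — far row (Kato + De Giorgi), near row (framed transplant + pin charge), centre row (`w = 0`),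
# with the member's FRAMES (`τ₁ ≤ t∕ℓ`, `τ₂ ≤ t∕ℓ²` on the pin balls) and the local MASS `𝓜` of `V = Δ_Uφ_H` DISPLAYED as hypotheses

Cell `ym3-torus`, width seat `ym3-torus-px11` (gen 3), LEAD of the (hK₂-cov) chain (routeR-w3 g6 WORDS (8)–(10), THE CUT 22:51:18Z: F4b∕F4c = px11); LOCATE 19200 evidence #57.
`--kind proof --supports stmt-QuantumFields-19200 --as helper`, count-neutral.  THEOREMS ONLY (0 `def`, 0 `sorry`).  YM₃ on T³ is a ladder rung (R3) — not d = 4, not infinite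
volume, not a mass gap, not the Clay problem; nothing here claims the stub, the crux or the gap.

THE POINT.  The `hK₂sup` binder of routeR-w3 g6's CLOSE ✓ `Prop7LinearCorrectorClose.linCorr_gauge_le_of_supplier_rows` asks, for the pinned interpolant `φ_H` (`φ_H = φ` on the
centres `C = embIter k '' T^{(k)}`, `Δ_U²φ_H = 0` off `C`) and every weight `0 ≤ w ≤ min(tdist(·,C), ℓ)`, the row `w(x)·‖Δ_U(φ − φ_H)(x)‖ ≤ C₂·ℓ·M`, `M = sup‖Δ_Uφ‖`.  Writing
`V := Δ_Uφ_H` (covariantly harmonic off `C`), `‖Δ_U(φ−φ_H)(x)‖ ≤ M + ‖V x‖`, and `w·M ≤ ℓM`; the file bounds `w(x)·‖V x‖` by `√𝓜∕√ℓ` (`𝓜` = the `hs`-mass of `V` on `ℓ`-balls) in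
the three regimes of LOCATE #57 §1: FAR (`tdist(x,C) > 12q`, `q = ⌊ℓ∕1024⌋`): ✓ `Prop7CovInteriorSubMeanValue.norm_sq_le_of_covHarmonic_off_of_far` (Kato + De Giorgi, frame-free) on
the ball `B(x,12q)`; NEAR (`0 < tdist(x,y) ≤ 12q` for a centre `y`): the framed pin row ✓ `Prop7CovInterpErrorPinRows.tdist_mul_norm_le_of_laplace_defect` for `v = R(Fr⁻¹)V`, its junk
sums by ✓ `Prop7CovPinJunkPhi.J1_le`, ✓ `Prop7CovPinJunkPhiSq.J2_le`, the centre comparison ✓ `Prop7CovPinJunkPhiSq.norm_laplace_framed_centre_le` and the charge ✓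
`Prop7CovPinCharge.norm_covLaplace_centre_le_of_cutoff` with the scale cutoff ✓ `Prop7TorusAgmonWeight.exists_scale_cutoff` (module `…TorusScaleCutoff`) at scale `ℓ∕20` (so that its support sits in the pin
ball `{s ≤ m}`, `m = ⌊(ℓ−1)∕2⌋`); CENTRE (`x = y`): `w(y) = 0`.  The member's data enter through TWO displayed hypotheses only — the (3.35) frames on the pin balls (px4 g3 ✓
`Prop7MemberBallFrames.exists_ballFrame_of_regPr` discharges them, `t = C′e^{C′∕ℓ}`) and the local mass (px4 g3 ✓ `Prop7CovInterpErrorLocalLaplaceEnergyT3` + the `M`-row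
discharge it, `𝓜 ≤ C_V ℓ³M²`) — F4c-cov plugs them and lands the `hK₂sup` shape verbatim.

WHAT IS PROVED (ns `…Theorems.Prop7CovWeightedLaplaceRow`; torus `Site P 0`, `P.d = 3`, `k ≤ m_P + K_P`, `ℓ = L^k ≥ 1024`, `q = ⌊ℓ∕1024⌋`, `m = ⌊(ℓ−1)∕2⌋`, `L²`-op norm on `M_N(ℂ)`,
`hs X = Σ_{jk}‖X_{jk}‖²`, `Δ_Uf x := divB T U (fun μ => covD T U μ f) x`).
(Scalar bookkeeping: FILE (i) ✓ `Prop7CovWeightedRowScalings`; far row, pin charge, scaled `J₁, J₂`, geometric letters: FILE (ii) ✓ `Prop7CovWeightedRowBricks`.)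
* §1 ★★ `charge_scaled_le`, ★ `centre_scaled_le` — the pin charge `‖Δ_UV(y)‖` and the framed centre value `‖Δ₁v(y)‖` are `≤ (2N²(129600 + 1200t(1+t)) + O(t(1+t)))·√𝓜∕√ℓ`.
* §2 ★★★ `tdist_mul_norm_le_near` — the NEAR row `tdist(x,y)·‖V x‖ ≤ A·(1+2N²)²(1+t)²·√𝓜_y∕√ℓ`.
* §3 ★★★ `weight_mul_norm_covLaplace_interp_error_le` — the WEIGHTED ROW of the title.
HONEST SCOPE.  Bookkeeping over landed bricks; nothing of Bałaban's is asserted; the member plug (F4c) is a separate file.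

References: T. Bałaban, CMP 102 (1985) 277–309 [Balaban1985Variational] (Prop. 7 p.299); CMP 99 (1985) 389–434 [Balaban1985BackgroundPropagators] ((3.8) p.392, (3.35) p.396);
M. Giaquinta, Multiple integrals in the calculus of variations, Princeton 1983 [Giaquinta1984] (Ch. III §1–§2).
-/

set_option autoImplicit false

noncomputable section

open scoped BigOperators Matrix.Norms.L2Operator Matrix
namespace Summit.QuantumFields.YangMills.Theorems.Prop7CovWeightedLaplaceRow

open Literature.MathematicalPhysics.QuantumFieldTheory.Balaban1983to89
open Finset
open LatticeFieldCalculus (laplace)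
open B9Eq39Adjoint (R covD divB)
open B9TorusCalculus (torusT torusT_apply)
open B3Taylor310LocalRemainder (tdist_comm tdist_self tdist_triangle)
open B15DeterminingSets (embIter)
open Summit.QuantumFields.YangMills.Theorems.Prop7CovPinJunkSums (tdist_shift_le_succ tdist_le_tdist_shift_succ norm_le_sqrt_hs)
open Summit.QuantumFields.YangMills.Theorems.Prop7CovPinCharge (norm_framed_eq)
open Summit.QuantumFields.YangMills.Theorems.Prop7CovPinJunkPhi (norm_le_sqrt_mass norm_covD_le_add tdist_unshift_le_succ)
open Summit.QuantumFields.YangMills.Theorems.Prop7CovPinJunkPhiSq (norm_laplace_framed_centre_le)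
open Summit.QuantumFields.YangMills.Theorems.Prop7CovInterpErrorPinRows (tdist_mul_norm_le_of_laplace_defect)
open Summit.QuantumFields.YangMills.Theorems.Prop7TorusRadialSums (card_ball_le_real)
open Summit.QuantumFields.YangMills.Theorems.Prop7CovWeightedRowScalings
open Summit.QuantumFields.YangMills.Theorems.Prop7CovWeightedRowBricks

variable {P : Params} {N : ℕ}

/-! ## §1 ★★ The scaled charge and centre rows at a pin -/

section Junk

variable {j : ℕ} (U : Fin P.d → Site P j → (Matrix (Fin N) (Fin N) ℂ)ˣ) (Fr : Site P j → (Matrix (Fin N) (Fin N) ℂ)ˣ)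

/-- ★★ **THE CHARGE SCALED**: `‖Δ_UV(y)‖ ≤ (2N²(129600 + 1200·t(1+t)) + 66·t(1+t))·√𝓜∕√ℓ` (§3 + `cutoff_const_le` + `J1_scaled_le` + the pin comparison rows).
[cite: Balaban1984PropagatorsII, (1.9) p.226; Balaban1985BackgroundPropagators, (3.35) p.396] -/
theorem charge_scaled_le (hd : P.d = 3) (hUu : ∀ ν x, (U ν x : Matrix (Fin N) (Fin N) ℂ) ∈ unitary (Matrix (Fin N) (Fin N) ℂ))
    (hU : ∀ (κ : Fin P.d) (w : Site P j), ‖(U κ w : Matrix (Fin N) (Fin N) ℂ)‖ ≤ 1 ∧ ‖(((U κ w)⁻¹ : (Matrix (Fin N) (Fin N) ℂ)ˣ) : Matrix (Fin N) (Fin N) ℂ)‖ ≤ 1)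
    (hFr : ∀ z, ‖(Fr z : Matrix (Fin N) (Fin N) ℂ)‖ ≤ 1 ∧ ‖(((Fr z)⁻¹ : (Matrix (Fin N) (Fin N) ℂ)ˣ) : Matrix (Fin N) (Fin N) ℂ)‖ ≤ 1)
    (V : Site P j → Matrix (Fin N) (Fin N) ℂ) (y : Site P j) {m : ℕ} (hm : 16 ≤ m)
    (hV : ∀ z, 0 < Site.tdist z y → Site.tdist z y ≤ 2 * m → divB (torusT P j) U (fun μ => covD (torusT P j) U μ V) z = 0)
    {ℓ t τ₁ τ₂ : ℝ} (hℓ : 1024 ≤ ℓ) (hm1 : ℓ ≤ 2 * (m : ℝ) + 2) (hm2 : 2 * (m : ℝ) + 1 ≤ ℓ) (ht : 0 ≤ t) (hτ₁ : τ₁ ≤ t / ℓ) (hτ₂ : τ₂ ≤ t / ℓ ^ 2)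
    (hrow1 : ∀ (μ : Fin P.d) (z : Site P j), Site.tdist z y ≤ m + 1 →
      ‖(((Fr z)⁻¹ * U μ z * Fr (torusT P j μ z) : (Matrix (Fin N) (Fin N) ℂ)ˣ) : Matrix (Fin N) (Fin N) ℂ) - 1‖ ≤ τ₁)
    (hrow2 : ∀ (μ : Fin P.d) (z : Site P j), Site.tdist z y ≤ m →
      ‖(((Fr z)⁻¹ * U μ z * Fr (torusT P j μ z) : (Matrix (Fin N) (Fin N) ℂ)ˣ) : Matrix (Fin N) (Fin N) ℂ)
        - (((Fr (z.unshift μ))⁻¹ * U μ (z.unshift μ) * Fr (torusT P j μ (z.unshift μ)) : (Matrix (Fin N) (Fin N) ℂ)ˣ) : Matrix (Fin N) (Fin N) ℂ)‖ ≤ τ₂) :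
    ‖divB (torusT P j) U (fun μ => covD (torusT P j) U μ V) y‖
      ≤ (2 * (N : ℝ) ^ 2 * (129600 + 1200 * t * (1 + t)) + 66 * t * (1 + t))
          * Real.sqrt (∑ z ∈ Finset.univ.filter (fun z : Site P j => Site.tdist z y ≤ 2 * m + 1), ∑ j' : Fin N, ∑ k' : Fin N, ‖(V z) j' k'‖ ^ 2)
          / Real.sqrt ℓ := by
  classical
  set Mass := ∑ z ∈ Finset.univ.filter (fun z : Site P j => Site.tdist z y ≤ 2 * m + 1), ∑ j' : Fin N, ∑ k' : Fin N, ‖(V z) j' k'‖ ^ 2 with hMass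
  set Q := Real.sqrt Mass with hQ
  have hQ0 : 0 ≤ Q := Real.sqrt_nonneg _
  have hℓ1 : 1 ≤ ℓ := by linarith
  obtain ⟨hr1, hrℓ, hrr, -⟩ := sqrt_letters hℓ1
  have hr0 : 0 < Real.sqrt ℓ := by linarith
  have hd' : (P.d : ℝ) = 3 := by exact_mod_cast hd
  have hτ₁0 : 0 ≤ τ₁ := (norm_nonneg _).trans (hrow1 ⟨0, P.hd⟩ y (by rw [tdist_self]; omega))
  -- the pin rows
  have h1 : ∀ μ, ‖(((Fr y)⁻¹ * U μ y * Fr (torusT P j μ y) : (Matrix (Fin N) (Fin N) ℂ)ˣ) : Matrix (Fin N) (Fin N) ℂ) - 1‖ ≤ τ₁ :=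
    fun μ => hrow1 μ y (by rw [tdist_self]; omega)
  have h1' : ∀ μ, ‖(((Fr (y.unshift μ))⁻¹ * U μ (y.unshift μ) * Fr (torusT P j μ (y.unshift μ)) : (Matrix (Fin N) (Fin N) ℂ)ˣ) : Matrix (Fin N) (Fin N) ℂ) - 1‖ ≤ τ₁ :=
    fun μ => hrow1 μ (y.unshift μ) ((tdist_unshift_le_succ y y μ).trans (by rw [tdist_self]; omega))
  have h2 : ∀ μ, ‖(((Fr y)⁻¹ * U μ y * Fr (torusT P j μ y) : (Matrix (Fin N) (Fin N) ℂ)ˣ) : Matrix (Fin N) (Fin N) ℂ)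
      - (((Fr (y.unshift μ))⁻¹ * U μ (y.unshift μ) * Fr (torusT P j μ (y.unshift μ)) : (Matrix (Fin N) (Fin N) ℂ)ˣ) : Matrix (Fin N) (Fin N) ℂ)‖ ≤ τ₂ :=
    fun μ => hrow2 μ y (by rw [tdist_self]; omega)
  have hch := norm_covLaplace_pin_le hd U hU Fr hFr V y hm h1 h1' h2
  rw [erase_ball_eq_punctured y m] at hch
  -- (a) the cutoff term
  have hcard := card_ball_le_real y m
  have e3 : (2 * ((m : ℝ) + 1)) ^ P.d = (2 * ((m : ℝ) + 1)) ^ 3 := by rw [hd]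
  rw [e3] at hcard
  have hcut := cutoff_const_le hℓ hm1 hm2 (Nat.cast_nonneg _) hcard
  have hballV : ∑ x ∈ Finset.univ.filter (fun x : Site P j => Site.tdist x y ≤ m), ‖V x‖ ^ 2 ≤ Mass :=
    (Finset.sum_le_sum fun x _ => MatrixNorms.opNorm_sq_le_sum_norm_sq (V x)).trans
      (sum_ball_mono y (by omega : m ≤ 2 * m + 1) _ fun z => Finset.sum_nonneg fun _ _ => Finset.sum_nonneg fun _ _ => sq_nonneg _)
  have hA : 2700 / (m : ℝ) ^ 2 * (Real.sqrt ((Finset.univ.filter (fun x : Site P j => Site.tdist x y ≤ m)).card : ℝ)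
      * Real.sqrt (∑ x ∈ Finset.univ.filter (fun x : Site P j => Site.tdist x y ≤ m), ‖V x‖ ^ 2)) ≤ 129600 / Real.sqrt ℓ * Q := by
    rw [← mul_assoc]
    exact mul_le_mul hcut (Real.sqrt_le_sqrt hballV) (Real.sqrt_nonneg _) (by positivity)
  -- (b) the junk sum
  have hJ1 := J1_scaled_le U Fr hd hUu hU hFr V y hm hV hℓ hm2 ht hτ₁ hτ₂ hrow1 hrow2
  -- (c) the pin comparison
  have hVle : ∀ w, Site.tdist w y ≤ 2 * m + 1 → ‖V w‖ ≤ Q := fun w hw => norm_le_sqrt_mass V y (2 * m + 1) w hw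
  have hVy : ‖V y‖ ≤ Q := hVle y (by rw [tdist_self]; omega)
  have hVs : ∀ μ, ‖V (y.shift μ)‖ ≤ Q := fun μ => hVle _ ((tdist_shift_le_succ y y μ).trans (by rw [tdist_self]; omega))
  have hVu : ∀ μ, ‖V (y.unshift μ)‖ ≤ Q := fun μ => hVle _ ((tdist_unshift_le_succ y y μ).trans (by rw [tdist_self]; omega))
  have hDy : ∀ μ, ‖covD (torusT P j) U μ V y‖ ≤ 2 * Q := fun μ => (norm_covD_le_add hU V μ y).trans (by linarith [hVs μ, hVy])
  have hDu : ∀ μ, ‖covD (torusT P j) U μ V (y.unshift μ)‖ ≤ 2 * Q := fun μ => by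
    have h := norm_covD_le_add hU V μ (y.unshift μ)
    rw [Site.shift_unshift] at h
    linarith [hVu μ, hVy]
  have hpin : ∑ μ : Fin P.d, (2 * τ₁ * (‖covD (torusT P j) U μ V y‖ + ‖covD (torusT P j) U μ V (y.unshift μ)‖ + 2 * τ₁ * (‖V (y.shift μ)‖ + ‖V y‖))
      + (2 * τ₂ + 4 * τ₁ ^ 2) * ‖V (y.unshift μ)‖) ≤ (24 * τ₁ + 6 * τ₂ + 36 * τ₁ ^ 2) * Q := by
    have hτ₂0 : 0 ≤ τ₂ := (norm_nonneg _).trans (h2 ⟨0, P.hd⟩)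
    have hterm : ∀ μ : Fin P.d, 2 * τ₁ * (‖covD (torusT P j) U μ V y‖ + ‖covD (torusT P j) U μ V (y.unshift μ)‖ + 2 * τ₁ * (‖V (y.shift μ)‖ + ‖V y‖))
        + (2 * τ₂ + 4 * τ₁ ^ 2) * ‖V (y.unshift μ)‖ ≤ (8 * τ₁ + 2 * τ₂ + 12 * τ₁ ^ 2) * Q := by
      intro μ
      have hc0 : 0 ≤ 2 * τ₂ + 4 * τ₁ ^ 2 := by positivity
      have h2τ : 0 ≤ 2 * τ₁ := by positivity
      have hA : 2 * τ₁ * (‖covD (torusT P j) U μ V y‖ + ‖covD (torusT P j) U μ V (y.unshift μ)‖ + 2 * τ₁ * (‖V (y.shift μ)‖ + ‖V y‖))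
          ≤ 2 * τ₁ * (2 * Q + 2 * Q + 2 * τ₁ * (Q + Q)) :=
        mul_le_mul_of_nonneg_left (add_le_add (add_le_add (hDy μ) (hDu μ)) (mul_le_mul_of_nonneg_left (add_le_add (hVs μ) hVy) h2τ)) h2τ
      have hB : (2 * τ₂ + 4 * τ₁ ^ 2) * ‖V (y.unshift μ)‖ ≤ (2 * τ₂ + 4 * τ₁ ^ 2) * Q := mul_le_mul_of_nonneg_left (hVu μ) hc0
      have e : 2 * τ₁ * (2 * Q + 2 * Q + 2 * τ₁ * (Q + Q)) + (2 * τ₂ + 4 * τ₁ ^ 2) * Q = (8 * τ₁ + 2 * τ₂ + 12 * τ₁ ^ 2) * Q := by ring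
      linarith
    refine (Finset.sum_le_sum fun μ _ => hterm μ).trans ?_
    rw [Finset.sum_const, Finset.card_univ, Fintype.card_fin, nsmul_eq_mul, hd']
    linarith
  have haff := affine_row_le ht hℓ1 hτ₁0 hτ₁ hτ₂ (by norm_num : (0:ℝ) ≤ 24) (by norm_num : (0:ℝ) ≤ 6) (by norm_num : (0:ℝ) ≤ 36)
  have hpin' : (24 * τ₁ + 6 * τ₂ + 36 * τ₁ ^ 2) * Q ≤ 66 * t * (1 + t) / Real.sqrt ℓ * Q := by
    refine mul_le_mul_of_nonneg_right (haff.trans (le_of_eq (by norm_num))) hQ0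
  -- assemble
  have hN0 : 0 ≤ 2 * (N : ℝ) ^ 2 := by positivity
  have e : (2 * (N : ℝ) ^ 2 * (129600 + 1200 * t * (1 + t)) + 66 * t * (1 + t)) * Q / Real.sqrt ℓ
      = 2 * (N : ℝ) ^ 2 * (129600 / Real.sqrt ℓ * Q + 1200 * t * (1 + t) * Q / Real.sqrt ℓ) + 66 * t * (1 + t) / Real.sqrt ℓ * Q := by
    ring
  rw [e]
  exact hch.trans (add_le_add (mul_le_mul_of_nonneg_left (add_le_add hA hJ1) hN0) (hpin.trans hpin'))

/-- ★ **THE CENTRE SCALED**: `‖Δ₁v(y)‖ ≤ (2N²(129600 + 1200·t(1+t)) + 96·t(1+t))·√𝓜∕√ℓ` (✓ `norm_laplace_framed_centre_le` + `charge_scaled_le`).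
[cite: Balaban1985BackgroundPropagators, (3.35) p.396] -/
theorem centre_scaled_le (hd : P.d = 3) (hUu : ∀ ν x, (U ν x : Matrix (Fin N) (Fin N) ℂ) ∈ unitary (Matrix (Fin N) (Fin N) ℂ))
    (hU : ∀ (κ : Fin P.d) (w : Site P j), ‖(U κ w : Matrix (Fin N) (Fin N) ℂ)‖ ≤ 1 ∧ ‖(((U κ w)⁻¹ : (Matrix (Fin N) (Fin N) ℂ)ˣ) : Matrix (Fin N) (Fin N) ℂ)‖ ≤ 1)
    (hFr : ∀ z, ‖(Fr z : Matrix (Fin N) (Fin N) ℂ)‖ ≤ 1 ∧ ‖(((Fr z)⁻¹ : (Matrix (Fin N) (Fin N) ℂ)ˣ) : Matrix (Fin N) (Fin N) ℂ)‖ ≤ 1)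
    (V : Site P j → Matrix (Fin N) (Fin N) ℂ) (y : Site P j) {m : ℕ} (hm : 16 ≤ m)
    (hV : ∀ z, 0 < Site.tdist z y → Site.tdist z y ≤ 2 * m → divB (torusT P j) U (fun μ => covD (torusT P j) U μ V) z = 0)
    {ℓ t τ₁ τ₂ : ℝ} (hℓ : 1024 ≤ ℓ) (hm1 : ℓ ≤ 2 * (m : ℝ) + 2) (hm2 : 2 * (m : ℝ) + 1 ≤ ℓ) (ht : 0 ≤ t) (hτ₁ : τ₁ ≤ t / ℓ) (hτ₂ : τ₂ ≤ t / ℓ ^ 2)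
    (hrow1 : ∀ (μ : Fin P.d) (z : Site P j), Site.tdist z y ≤ m + 1 →
      ‖(((Fr z)⁻¹ * U μ z * Fr (torusT P j μ z) : (Matrix (Fin N) (Fin N) ℂ)ˣ) : Matrix (Fin N) (Fin N) ℂ) - 1‖ ≤ τ₁)
    (hrow2 : ∀ (μ : Fin P.d) (z : Site P j), Site.tdist z y ≤ m →
      ‖(((Fr z)⁻¹ * U μ z * Fr (torusT P j μ z) : (Matrix (Fin N) (Fin N) ℂ)ˣ) : Matrix (Fin N) (Fin N) ℂ)
        - (((Fr (z.unshift μ))⁻¹ * U μ (z.unshift μ) * Fr (torusT P j μ (z.unshift μ)) : (Matrix (Fin N) (Fin N) ℂ)ˣ) : Matrix (Fin N) (Fin N) ℂ)‖ ≤ τ₂) :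
    ‖laplace 1 (fun w => R (Fr w)⁻¹ (V w)) y‖
      ≤ (2 * (N : ℝ) ^ 2 * (129600 + 1200 * t * (1 + t)) + 96 * t * (1 + t))
          * Real.sqrt (∑ z ∈ Finset.univ.filter (fun z : Site P j => Site.tdist z y ≤ 2 * m + 1), ∑ j' : Fin N, ∑ k' : Fin N, ‖(V z) j' k'‖ ^ 2)
          / Real.sqrt ℓ := by
  set Q := Real.sqrt (∑ z ∈ Finset.univ.filter (fun z : Site P j => Site.tdist z y ≤ 2 * m + 1), ∑ j' : Fin N, ∑ k' : Fin N, ‖(V z) j' k'‖ ^ 2) with hQ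
  have hQ0 : 0 ≤ Q := Real.sqrt_nonneg _
  have hℓ1 : 1 ≤ ℓ := by linarith
  have hτ₁0 : 0 ≤ τ₁ := (norm_nonneg _).trans (hrow1 ⟨0, P.hd⟩ y (by rw [tdist_self]; omega))
  have h1 : ∀ μ, ‖(((Fr y)⁻¹ * U μ y * Fr (torusT P j μ y) : (Matrix (Fin N) (Fin N) ℂ)ˣ) : Matrix (Fin N) (Fin N) ℂ) - 1‖ ≤ τ₁ :=
    fun μ => hrow1 μ y (by rw [tdist_self]; omega)
  have h1' : ∀ μ, ‖(((Fr (y.unshift μ))⁻¹ * U μ (y.unshift μ) * Fr (torusT P j μ (y.unshift μ)) : (Matrix (Fin N) (Fin N) ℂ)ˣ) : Matrix (Fin N) (Fin N) ℂ) - 1‖ ≤ τ₁ :=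
    fun μ => hrow1 μ (y.unshift μ) ((tdist_unshift_le_succ y y μ).trans (by rw [tdist_self]; omega))
  have h2 : ∀ μ, ‖(((Fr y)⁻¹ * U μ y * Fr (torusT P j μ y) : (Matrix (Fin N) (Fin N) ℂ)ˣ) : Matrix (Fin N) (Fin N) ℂ)
      - (((Fr (y.unshift μ))⁻¹ * U μ (y.unshift μ) * Fr (torusT P j μ (y.unshift μ)) : (Matrix (Fin N) (Fin N) ℂ)ˣ) : Matrix (Fin N) (Fin N) ℂ)‖ ≤ τ₂ :=
    fun μ => hrow2 μ y (by rw [tdist_self]; omega)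
  have hcen := norm_laplace_framed_centre_le U Fr hd hU hFr V y (by omega : 1 ≤ m) h1 h1' h2
  have hch := charge_scaled_le U Fr hd hUu hU hFr V y hm hV hℓ hm1 hm2 ht hτ₁ hτ₂ hrow1 hrow2
  have haff := affine_row_le ht hℓ1 hτ₁0 hτ₁ hτ₂ (by norm_num : (0:ℝ) ≤ 12) (by norm_num : (0:ℝ) ≤ 6) (by norm_num : (0:ℝ) ≤ 12)
  have hjunk : (12 * τ₁ + 6 * τ₂ + 12 * τ₁ ^ 2) * Q ≤ 30 * t * (1 + t) / Real.sqrt ℓ * Q :=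
    mul_le_mul_of_nonneg_right (haff.trans (le_of_eq (by norm_num))) hQ0
  have e : (2 * (N : ℝ) ^ 2 * (129600 + 1200 * t * (1 + t)) + 96 * t * (1 + t)) * Q / Real.sqrt ℓ
      = (2 * (N : ℝ) ^ 2 * (129600 + 1200 * t * (1 + t)) + 66 * t * (1 + t)) * Q / Real.sqrt ℓ + 30 * t * (1 + t) / Real.sqrt ℓ * Q := by ring
  rw [e]
  exact hcen.trans (add_le_add hch hjunk)

end Junk

/-! ## §2 ★★★ The NEAR row -/

section Near

/-- ★★★ **THE NEAR ROW**: there is `A > 0` (depending on `N` only through the flat-kernel constants of ✓ `tdist_mul_norm_le_of_laplace_defect`) such that for every torus with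
`d = 3`, `ℓ = L^k ≥ 1024`, a unitary bi-contractive `U`, a bi-contractive frame `Fr` with rows `τ₁ ≤ t∕ℓ` (on `tdist ≤ m+1`) and backward rows `τ₂ ≤ t∕ℓ²` (on `tdist ≤ m`) around the
centre `y = embIter k y₀` (`m = ⌊(ℓ−1)∕2⌋`), and a matrix field `V` covariantly harmonic on `{0 < tdist(·,y) ≤ 2m}`: for `x ≠ y` with `tdist(x,y) ≤ 13⌊ℓ∕1024⌋ + 18`,
`tdist(x,y)·‖V x‖ ≤ A·(1+2N²)²·(1+t)²·√(Σ_{tdist ≤ 2m+1} hs V)∕√ℓ`. [cite: Balaban1985Variational, Prop. 7 p.299; Balaban1985BackgroundPropagators, (3.35) p.396; Giaquinta1984, Ch. III §2] -/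
theorem tdist_mul_norm_le_near : ∃ A : ℝ, 0 < A ∧
    ∀ (P : Params) (_ : P.d = 3) (k : ℕ) (_ : k ≤ P.m + P.K) (_ : 1024 ≤ P.L ^ k)
      (U : Fin P.d → Site P 0 → (Matrix (Fin N) (Fin N) ℂ)ˣ)
      (_ : ∀ ν x, (U ν x : Matrix (Fin N) (Fin N) ℂ) ∈ unitary (Matrix (Fin N) (Fin N) ℂ))
      (_ : ∀ (κ : Fin P.d) (w : Site P 0), ‖(U κ w : Matrix (Fin N) (Fin N) ℂ)‖ ≤ 1 ∧ ‖(((U κ w)⁻¹ : (Matrix (Fin N) (Fin N) ℂ)ˣ) : Matrix (Fin N) (Fin N) ℂ)‖ ≤ 1)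
      (Fr : Site P 0 → (Matrix (Fin N) (Fin N) ℂ)ˣ)
      (_ : ∀ z, ‖(Fr z : Matrix (Fin N) (Fin N) ℂ)‖ ≤ 1 ∧ ‖(((Fr z)⁻¹ : (Matrix (Fin N) (Fin N) ℂ)ˣ) : Matrix (Fin N) (Fin N) ℂ)‖ ≤ 1)
      (V : Site P 0 → Matrix (Fin N) (Fin N) ℂ) (y₀ : Site P k)
      (_ : ∀ z, 0 < Site.tdist z (embIter k y₀) → Site.tdist z (embIter k y₀) ≤ 2 * ((P.L ^ k - 1) / 2) →
        divB (torusT P 0) U (fun μ => covD (torusT P 0) U μ V) z = 0)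
      (t τ₁ τ₂ : ℝ) (_ : 0 ≤ t) (_ : τ₁ ≤ t / (P.L : ℝ) ^ k) (_ : τ₂ ≤ t / ((P.L : ℝ) ^ k) ^ 2)
      (_ : ∀ (μ : Fin P.d) (z : Site P 0), Site.tdist z (embIter k y₀) ≤ (P.L ^ k - 1) / 2 + 1 →
        ‖(((Fr z)⁻¹ * U μ z * Fr (torusT P 0 μ z) : (Matrix (Fin N) (Fin N) ℂ)ˣ) : Matrix (Fin N) (Fin N) ℂ) - 1‖ ≤ τ₁)
      (_ : ∀ (μ : Fin P.d) (z : Site P 0), Site.tdist z (embIter k y₀) ≤ (P.L ^ k - 1) / 2 →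
        ‖(((Fr z)⁻¹ * U μ z * Fr (torusT P 0 μ z) : (Matrix (Fin N) (Fin N) ℂ)ˣ) : Matrix (Fin N) (Fin N) ℂ)
          - (((Fr (z.unshift μ))⁻¹ * U μ (z.unshift μ) * Fr (torusT P 0 μ (z.unshift μ)) : (Matrix (Fin N) (Fin N) ℂ)ˣ) : Matrix (Fin N) (Fin N) ℂ)‖ ≤ τ₂)
      (x : Site P 0) (_ : x ≠ embIter k y₀) (_ : Site.tdist x (embIter k y₀) ≤ 13 * (P.L ^ k / 1024) + 18),
      (Site.tdist x (embIter k y₀) : ℝ) * ‖V x‖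
        ≤ A * (1 + 2 * (N : ℝ) ^ 2) ^ 2 * (1 + t) ^ 2
            * Real.sqrt (∑ z ∈ Finset.univ.filter (fun z : Site P 0 => Site.tdist z (embIter k y₀) ≤ 2 * ((P.L ^ k - 1) / 2) + 1),
                ∑ j' : Fin N, ∑ k' : Fin N, ‖(V z) j' k'‖ ^ 2) / Real.sqrt ((P.L : ℝ) ^ k) := by
  obtain ⟨Cp, CK, A₁, hCp, hCK, hA₁, hF⟩ := tdist_mul_norm_le_of_laplace_defect (N := N)
  refine ⟨Cp * (132098 + 242 * Real.sqrt A₁) + 86 * Real.sqrt CK + 1, by positivity, ?_⟩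
  intro P hd k hk hℓ U hUu hU Fr hFr V y₀ hV t τ₁ τ₂ ht hτ₁ hτ₂ hrow1 hrow2 x hxy hx
  classical
  obtain ⟨hm3, h2m1, h2m2, -⟩ := half_letters hℓ
  obtain ⟨hq1, hqℓ, -⟩ := quotient_letters hℓ
  have hcast : ((P.L ^ k : ℕ) : ℝ) = (P.L : ℝ) ^ k := by push_cast; rfl
  have hℓr1024 : (1024 : ℝ) ≤ (P.L : ℝ) ^ k := by rw [← hcast]; exact_mod_cast hℓ
  have hℓ1 : (1 : ℝ) ≤ (P.L : ℝ) ^ k := by linarith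
  have hm16 : 16 ≤ (P.L ^ k - 1) / 2 := by omega
  have hm2r : 2 * (((P.L ^ k - 1) / 2 : ℕ) : ℝ) + 1 ≤ (P.L : ℝ) ^ k := by rw [← hcast]; exact_mod_cast h2m1
  have hm1r : (P.L : ℝ) ^ k ≤ 2 * (((P.L ^ k - 1) / 2 : ℕ) : ℝ) + 2 := by rw [← hcast]; exact_mod_cast h2m2
  obtain ⟨hr1, -, -, -⟩ := sqrt_letters hℓ1
  have hr0 : 0 < Real.sqrt ((P.L : ℝ) ^ k) := by linarith
  have hMass0 : 0 ≤ ∑ z ∈ Finset.univ.filter (fun z : Site P 0 => Site.tdist z (embIter k y₀) ≤ 2 * ((P.L ^ k - 1) / 2) + 1),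
      ∑ j' : Fin N, ∑ k' : Fin N, ‖(V z) j' k'‖ ^ 2 := Finset.sum_nonneg fun _ _ => Finset.sum_nonneg fun _ _ => Finset.sum_nonneg fun _ _ => sq_nonneg _
  -- the framed pin row (F3c) for `v = R(Fr⁻¹)V`
  have hvx : ‖(fun w => R (Fr w)⁻¹ (V w)) x‖ = ‖V x‖ := norm_framed_eq Fr hFr V x
  have hmain := hF P hd k hk hℓ y₀ (fun w => R (Fr w)⁻¹ (V w)) x hxy hx
  rw [ball_erase_eq_punctured (embIter k y₀) hℓ, hvx] at hmain
  -- the junk rows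
  have hJ2 := J2_scaled_le U Fr hd hUu hU hFr V (embIter k y₀) hm16 hV hℓr1024 hm2r ht hτ₁ hτ₂ hrow1 hrow2
  have hJ1 := J1_scaled_le U Fr hd hUu hU hFr V (embIter k y₀) hm16 hV hℓr1024 hm2r ht hτ₁ hτ₂ hrow1 hrow2
  have hcen := centre_scaled_le U Fr hd hUu hU hFr V (embIter k y₀) hm16 hV hℓr1024 hm1r hm2r ht hτ₁ hτ₂ hrow1 hrow2
  -- the half-ball mass of `v`
  have hMB : ∑ z ∈ Finset.univ.filter (fun z : Site P 0 => (Site.tdist z (embIter k y₀) : ℝ) < (P.L : ℝ) ^ k / 2), ‖(fun w => R (Fr w)⁻¹ (V w)) z‖ ^ 2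
      ≤ ∑ z ∈ Finset.univ.filter (fun z : Site P 0 => Site.tdist z (embIter k y₀) ≤ 2 * ((P.L ^ k - 1) / 2) + 1), ∑ j' : Fin N, ∑ k' : Fin N, ‖(V z) j' k'‖ ^ 2 := by
    refine (Finset.sum_le_sum_of_subset_of_nonneg (ball_half_subset (embIter k y₀) hℓ (2 * ((P.L ^ k - 1) / 2) + 1) (by omega))
      (fun z _ _ => sq_nonneg _)).trans (Finset.sum_le_sum fun z _ => ?_)
    rw [norm_framed_eq Fr hFr V z]
    exact MatrixNorms.opNorm_sq_le_sum_norm_sq (V z)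
  have hMB0 : 0 ≤ ∑ z ∈ Finset.univ.filter (fun z : Site P 0 => (Site.tdist z (embIter k y₀) : ℝ) < (P.L : ℝ) ^ k / 2), ‖(fun w => R (Fr w)⁻¹ (V w)) z‖ ^ 2 :=
    Finset.sum_nonneg fun _ _ => sq_nonneg _
  -- the two `√` terms
  have hfirst := first_term_le (A₁ := A₁) ht hℓ1 hA₁ hMB0 hMB hJ2
  have hs0 : (0 : ℝ) ≤ (Site.tdist x (embIter k y₀) : ℝ) := Nat.cast_nonneg _
  have hsℓ : (Site.tdist x (embIter k y₀) : ℝ) ≤ (P.L : ℝ) ^ k := by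
    rw [← hcast]
    have h : Site.tdist x (embIter k y₀) ≤ P.L ^ k := by have := hx; omega
    exact_mod_cast h
  have hJ20 : 0 ≤ ∑ z ∈ Finset.univ.filter (fun z : Site P 0 => 1 ≤ Site.tdist z (embIter k y₀) ∧ Site.tdist z (embIter k y₀) ≤ (P.L ^ k - 1) / 2),
      ((Site.tdist z (embIter k y₀) : ℕ) : ℝ) ^ 2 * ‖laplace 1 (fun w => R (Fr w)⁻¹ (V w)) z‖ ^ 2 := Finset.sum_nonneg fun _ _ => by positivity
  have hpot := potential_term_le ht hℓ1 hCK hs0 hsℓ hJ20 hMass0 hJ2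
  exact near_algebra ht (Real.sqrt_nonneg _) hr0 hCp hmain hfirst hcen hJ1 hpot

end Near

/-! ## §3 ★★★ The WEIGHTED ROW -/

section Main

open Summit.QuantumFields.YangMills.Theorems.Prop7CovInterpKernelDual (covLaplace_sub)

/-- ★★★ **THE (hK₂-cov) WEIGHTED LAPLACIAN ROW OF THE PINNED-BIHARMONIC INTERPOLATION ERROR, GENERIC TORUS, FRAMES AND MASS DISPLAYED.**  There is `A > 0` such that for every torus
with `d = 3`, `k ≤ m_P + K_P`, `ℓ = L^k ≥ 1024`, every unitary bi-contractive `U`, all `φ, φ_H` with `Δ_U²φ_H = 0` off the `k`-centres, `M ≥ sup‖Δ_Uφ‖`, frames `Fr` on every pin ball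
`{tdist(·, embIter k y₀) ≤ ℓ}` with rows `‖h_μ − 1‖ ≤ τ₁ ≤ t∕ℓ`, `‖h_μ(·+e_ν) − h_μ‖ ≤ τ₂ ≤ t∕ℓ²` (`h_μ z = Fr(z)⁻¹U_μ(z)Fr(z+e_μ)`), a local `hs`-mass bound `Σ_{tdist(z,x₀) ≤ ℓ} hs(Δ_Uφ_H)(z) ≤ 𝓜`
for every `x₀`, and every weight `0 ≤ w ≤ min(tdist(·,C), ℓ)`:
`w(x)·‖Δ_U(φ − φ_H)(x)‖ ≤ ℓ·M + A·(1+2N²)²·(1+t)²·√𝓜∕√ℓ` for every `x` (§2 far ∕ §5 near ∕ `w = 0` at a centre).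
[cite: Balaban1985Variational, Prop. 7 p.299; Balaban1985BackgroundPropagators, (3.8) p.392, (3.35) p.396; Giaquinta1984, Ch. III §2] -/
theorem weight_mul_norm_covLaplace_interp_error_le : ∃ A : ℝ, 0 < A ∧
    ∀ (P : Params) (_ : P.d = 3) (k : ℕ) (_ : k ≤ P.m + P.K) (_ : 1024 ≤ P.L ^ k)
      (U : Fin P.d → Site P 0 → (Matrix (Fin N) (Fin N) ℂ)ˣ)
      (_ : ∀ ν x, (U ν x : Matrix (Fin N) (Fin N) ℂ) ∈ unitary (Matrix (Fin N) (Fin N) ℂ))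
      (_ : ∀ (κ : Fin P.d) (w : Site P 0), ‖(U κ w : Matrix (Fin N) (Fin N) ℂ)‖ ≤ 1 ∧ ‖(((U κ w)⁻¹ : (Matrix (Fin N) (Fin N) ℂ)ˣ) : Matrix (Fin N) (Fin N) ℂ)‖ ≤ 1)
      (φ φH : Site P 0 → Matrix (Fin N) (Fin N) ℂ)
      (_ : ∀ x : Site P 0, x ∉ Set.range (embIter (P := P) k) →
        divB (torusT P 0) U (fun μ => covD (torusT P 0) U μ
          (fun y => divB (torusT P 0) U (fun ν => covD (torusT P 0) U ν φH) y)) x = 0)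
      (M : ℝ) (_ : ∀ z, ‖divB (torusT P 0) U (fun μ => covD (torusT P 0) U μ φ) z‖ ≤ M)
      (t τ₁ τ₂ : ℝ) (_ : 0 ≤ t) (_ : τ₁ ≤ t / (P.L : ℝ) ^ k) (_ : τ₂ ≤ t / ((P.L : ℝ) ^ k) ^ 2)
      (_ : ∀ y₀ : Site P k, ∃ Fr : Site P 0 → (Matrix (Fin N) (Fin N) ℂ)ˣ,
        (∀ z, ‖(Fr z : Matrix (Fin N) (Fin N) ℂ)‖ ≤ 1 ∧ ‖(((Fr z)⁻¹ : (Matrix (Fin N) (Fin N) ℂ)ˣ) : Matrix (Fin N) (Fin N) ℂ)‖ ≤ 1) ∧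
        (∀ (μ : Fin P.d) (z : Site P 0), Site.tdist z (embIter k y₀) ≤ P.L ^ k →
          ‖(((Fr z)⁻¹ * U μ z * Fr (torusT P 0 μ z) : (Matrix (Fin N) (Fin N) ℂ)ˣ) : Matrix (Fin N) (Fin N) ℂ) - 1‖ ≤ τ₁) ∧
        (∀ (μ ν : Fin P.d) (z : Site P 0), Site.tdist z (embIter k y₀) ≤ P.L ^ k →
          ‖(((Fr (torusT P 0 ν z))⁻¹ * U μ (torusT P 0 ν z) * Fr (torusT P 0 μ (torusT P 0 ν z)) : (Matrix (Fin N) (Fin N) ℂ)ˣ) : Matrix (Fin N) (Fin N) ℂ)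
              - (((Fr z)⁻¹ * U μ z * Fr (torusT P 0 μ z) : (Matrix (Fin N) (Fin N) ℂ)ˣ) : Matrix (Fin N) (Fin N) ℂ)‖ ≤ τ₂))
      (𝓜 : ℝ) (_ : ∀ x₀ : Site P 0, ∑ z ∈ Finset.univ.filter (fun z : Site P 0 => Site.tdist z x₀ ≤ P.L ^ k),
        ∑ j' : Fin N, ∑ k' : Fin N, ‖(divB (torusT P 0) U (fun ν => covD (torusT P 0) U ν φH) z) j' k'‖ ^ 2 ≤ 𝓜)
      (w : Site P 0 → ℝ) (_ : ∀ (x : Site P 0) (y₀ : Site P k), w x ≤ (Site.tdist x (embIter k y₀) : ℝ)) (_ : ∀ x, w x ≤ (P.L : ℝ) ^ k) (_ : ∀ x, 0 ≤ w x)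
      (x : Site P 0),
      w x * ‖divB (torusT P 0) U (fun μ => covD (torusT P 0) U μ (fun y => φ y - φH y)) x‖
        ≤ (P.L : ℝ) ^ k * M + A * (1 + 2 * (N : ℝ) ^ 2) ^ 2 * (1 + t) ^ 2 * Real.sqrt 𝓜 / Real.sqrt ((P.L : ℝ) ^ k) := by
  obtain ⟨A, hA, hnear⟩ := tdist_mul_norm_le_near (N := N)
  refine ⟨A + 2 ^ 35, by positivity, ?_⟩
  intro P hd k hk hℓ U hUu hU φ φH hEL M hM t τ₁ τ₂ ht hτ₁ hτ₂ hfr 𝓜 hmass w hwC hwℓ hw0 x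
  classical
  obtain ⟨hm3, h2m1, h2m2, -⟩ := half_letters hℓ
  obtain ⟨hq1, hqℓ, -⟩ := quotient_letters hℓ
  have hL0 : (0 : ℝ) < (P.L : ℝ) := by exact_mod_cast P.L_pos
  have hℓpos : (0 : ℝ) < (P.L : ℝ) ^ k := pow_pos hL0 k
  have hℓ1 : (1 : ℝ) ≤ (P.L : ℝ) ^ k := one_le_pow₀ (by exact_mod_cast P.L_pos)
  obtain ⟨hr1, -, hrr, -⟩ := sqrt_letters hℓ1
  have hr0 : 0 < Real.sqrt ((P.L : ℝ) ^ k) := by linarith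
  have hM0 : 0 ≤ M := (norm_nonneg _).trans (hM x)
  have hhs0 : ∀ z : Site P 0, 0 ≤ ∑ j' : Fin N, ∑ k' : Fin N, ‖(divB (torusT P 0) U (fun ν => covD (torusT P 0) U ν φH) z) j' k'‖ ^ 2 :=
    fun z => Finset.sum_nonneg fun _ _ => Finset.sum_nonneg fun _ _ => sq_nonneg _
  have h𝓜0 : 0 ≤ 𝓜 := (Finset.sum_nonneg fun z _ => hhs0 z).trans (hmass x)
  set K : ℝ := (1 + 2 * (N : ℝ) ^ 2) ^ 2 * (1 + t) ^ 2 with hK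
  have hK1 : 1 ≤ K := by
    rw [hK]
    have hN1 : (1 : ℝ) ≤ 1 + 2 * (N : ℝ) ^ 2 := by have := sq_nonneg (N : ℝ); linarith
    exact one_le_mul_of_one_le_of_one_le (one_le_pow₀ hN1) (one_le_pow₀ (by linarith : (1 : ℝ) ≤ 1 + t))
  have hunit0 : 0 ≤ Real.sqrt 𝓜 / Real.sqrt ((P.L : ℝ) ^ k) := by positivity
  -- pointwise split `‖Δ_U(φ − φ_H)(x)‖ ≤ M + ‖V x‖`
  have hsplit : ‖divB (torusT P 0) U (fun μ => covD (torusT P 0) U μ (fun y => φ y - φH y)) x‖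
      ≤ M + ‖divB (torusT P 0) U (fun ν => covD (torusT P 0) U ν φH) x‖ := by
    rw [covLaplace_sub (U := U) φ φH x]
    have h2 := norm_sub_le (divB (torusT P 0) U (fun μ => covD (torusT P 0) U μ φ) x) (divB (torusT P 0) U (fun ν => covD (torusT P 0) U ν φH) x)
    linarith [hM x]
  -- the key row for `V`
  suffices hkey : w x * ‖divB (torusT P 0) U (fun ν => covD (torusT P 0) U ν φH) x‖ ≤ (A + 2 ^ 35) * K * (Real.sqrt 𝓜 / Real.sqrt ((P.L : ℝ) ^ k)) by
    have e : (P.L : ℝ) ^ k * M + (A + 2 ^ 35) * (1 + 2 * (N : ℝ) ^ 2) ^ 2 * (1 + t) ^ 2 * Real.sqrt 𝓜 / Real.sqrt ((P.L : ℝ) ^ k)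
        = (P.L : ℝ) ^ k * M + (A + 2 ^ 35) * K * (Real.sqrt 𝓜 / Real.sqrt ((P.L : ℝ) ^ k)) := by rw [hK]; ring
    rw [e]
    calc w x * ‖divB (torusT P 0) U (fun μ => covD (torusT P 0) U μ (fun y => φ y - φH y)) x‖
        ≤ w x * (M + ‖divB (torusT P 0) U (fun ν => covD (torusT P 0) U ν φH) x‖) := mul_le_mul_of_nonneg_left hsplit (hw0 x)
      _ = w x * M + w x * ‖divB (torusT P 0) U (fun ν => covD (torusT P 0) U ν φH) x‖ := by ring
      _ ≤ (P.L : ℝ) ^ k * M + (A + 2 ^ 35) * K * (Real.sqrt 𝓜 / Real.sqrt ((P.L : ℝ) ^ k)) :=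
          add_le_add (mul_le_mul_of_nonneg_right (hwℓ x) hM0) hkey
  by_cases hcase : ∃ y₀ : Site P k, Site.tdist x (embIter k y₀) ≤ 12 * (P.L ^ k / 1024)
  · obtain ⟨y₀, hy₀⟩ := hcase
    by_cases hxy : x = embIter k y₀
    · -- at the centre the weight vanishes
      have hwx : w x ≤ 0 := by
        have h := hwC x y₀
        rw [← hxy, tdist_self] at h; exact_mod_cast h
      have hw00 : w x = 0 := le_antisymm hwx (hw0 x)
      rw [hw00, zero_mul]; positivity
    · -- the near row
      obtain ⟨Fr, hFr, hrow1, hrow2f⟩ := hfr y₀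
      have hV := covHarmonic_near_pin_of_off_centres hk
        (fun z => divB (torusT P 0) U (fun μ => covD (torusT P 0) U μ (fun y => divB (torusT P 0) U (fun ν => covD (torusT P 0) U ν φH) y)) z)
        0 hEL y₀ (r := 2 * ((P.L ^ k - 1) / 2)) (by omega)
      have hrow1' : ∀ (μ : Fin P.d) (z : Site P 0), Site.tdist z (embIter k y₀) ≤ (P.L ^ k - 1) / 2 + 1 →
          ‖(((Fr z)⁻¹ * U μ z * Fr (torusT P 0 μ z) : (Matrix (Fin N) (Fin N) ℂ)ˣ) : Matrix (Fin N) (Fin N) ℂ) - 1‖ ≤ τ₁ :=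
        fun μ z hz => hrow1 μ z (by omega)
      have hrow2' := fun (μ : Fin P.d) (z : Site P 0) (hz : Site.tdist z (embIter k y₀) ≤ (P.L ^ k - 1) / 2) =>
        backward_row_of_forward U Fr (embIter k y₀) (r := (P.L ^ k - 1) / 2) (fun μ' ν' x' hx' => hrow2f μ' ν' x' (by omega)) μ z hz
      have h := hnear P hd k hk hℓ U hUu hU Fr hFr (fun y => divB (torusT P 0) U (fun ν => covD (torusT P 0) U ν φH) y) y₀ hV
        t τ₁ τ₂ ht hτ₁ hτ₂ hrow1' hrow2' x hxy (by omega)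
      have hMy : ∑ z ∈ Finset.univ.filter (fun z : Site P 0 => Site.tdist z (embIter k y₀) ≤ 2 * ((P.L ^ k - 1) / 2) + 1),
          ∑ j' : Fin N, ∑ k' : Fin N, ‖(divB (torusT P 0) U (fun ν => covD (torusT P 0) U ν φH) z) j' k'‖ ^ 2 ≤ 𝓜 :=
        (sum_ball_mono (embIter k y₀) h2m1 _ hhs0).trans (hmass (embIter k y₀))
      calc w x * ‖divB (torusT P 0) U (fun ν => covD (torusT P 0) U ν φH) x‖
          ≤ (Site.tdist x (embIter k y₀) : ℝ) * ‖divB (torusT P 0) U (fun ν => covD (torusT P 0) U ν φH) x‖ :=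
            mul_le_mul_of_nonneg_right (hwC x y₀) (norm_nonneg _)
        _ ≤ A * (1 + 2 * (N : ℝ) ^ 2) ^ 2 * (1 + t) ^ 2 * Real.sqrt (∑ z ∈ Finset.univ.filter (fun z : Site P 0 => Site.tdist z (embIter k y₀) ≤ 2 * ((P.L ^ k - 1) / 2) + 1),
              ∑ j' : Fin N, ∑ k' : Fin N, ‖(divB (torusT P 0) U (fun ν => covD (torusT P 0) U ν φH) z) j' k'‖ ^ 2) / Real.sqrt ((P.L : ℝ) ^ k) := h
        _ ≤ A * (1 + 2 * (N : ℝ) ^ 2) ^ 2 * (1 + t) ^ 2 * Real.sqrt 𝓜 / Real.sqrt ((P.L : ℝ) ^ k) := by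
            refine div_le_div_of_nonneg_right (mul_le_mul_of_nonneg_left (Real.sqrt_le_sqrt hMy) (by positivity)) hr0.le
        _ = A * K * (Real.sqrt 𝓜 / Real.sqrt ((P.L : ℝ) ^ k)) := by rw [hK]; ring
        _ ≤ (A + 2 ^ 35) * K * (Real.sqrt 𝓜 / Real.sqrt ((P.L : ℝ) ^ k)) := by
            refine mul_le_mul_of_nonneg_right (mul_le_mul_of_nonneg_right (by norm_num) (by linarith)) hunit0
  · -- the far row
    have hfar : ∀ y₀ : Site P k, 12 * (P.L ^ k / 1024) < Site.tdist x (embIter k y₀) := fun y₀ => not_le.1 fun h => hcase ⟨y₀, h⟩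
    have h := norm_le_far hd hk hℓ U hU (fun y => divB (torusT P 0) U (fun ν => covD (torusT P 0) U ν φH) y) hEL x hfar
    have hMx := hmass x
    calc w x * ‖divB (torusT P 0) U (fun ν => covD (torusT P 0) U ν φH) x‖
        ≤ (P.L : ℝ) ^ k * (2 ^ 35 / (((P.L : ℝ) ^ k) * Real.sqrt ((P.L : ℝ) ^ k)) * Real.sqrt 𝓜) := by
          refine mul_le_mul (hwℓ x) (h.trans (mul_le_mul_of_nonneg_left (Real.sqrt_le_sqrt hMx) (by positivity))) (norm_nonneg _) hℓpos.le
      _ = 2 ^ 35 * (Real.sqrt 𝓜 / Real.sqrt ((P.L : ℝ) ^ k)) := by field_simp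
      _ ≤ (A + 2 ^ 35) * K * (Real.sqrt 𝓜 / Real.sqrt ((P.L : ℝ) ^ k)) := by
          refine mul_le_mul_of_nonneg_right ?_ hunit0
          have h1 : (A + 2 ^ 35) * 1 ≤ (A + 2 ^ 35) * K := mul_le_mul_of_nonneg_left hK1 (by positivity)
          linarith

end Main

end Summit.QuantumFields.YangMills.Theorems.Prop7CovWeightedLaplaceRow

end
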